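import Summits.CriticalPhenomena.PercolationContinuityZ3.Theorems.PercNearOneGluingNoHeavyQuantFarGate3BoxPolyPFast
import HarnessLib

/-!
# QUANT lane R8, front "FAR beyond trees", layer one — THE DEGREE-THREE GATE AT THE OBSERVER, LXV: generic box-certificate engine over kernel N — DEFINITIONS
# (`CertN.Spec`, the chart system `Bad`, certificates, box-relative multiplier factors, the assembled tensors `polyOf`/`polyOfV`, the checker `check`)

builds on p205010 (kernel theorem, internal audit signed; external expert review pending)

Support file (`--supports stmt-CriticalPhenomena-4575`), seat `prim-quant-p1` (gen 35); memo
`run/shared/lean/prim/quant/prim-quant-p1-g35/FOR-LEAD-GATE3-PINCH.md`.  Kernel N-II/N-III (files LXIII, LXIV, LXIV-b/c) only; standard axioms; no sorries.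

ONE certificate engine for EVERY blow-up chart of the degree-three gate (instead of one `Tables/CertU/CertK/CertE/CertS/Cover` sextet per chart as for
charts C and D, files XLIX–LI, LVIII–LX): a chart is now DATA — a `CertN.Spec` = the integer coefficient tables of its five scaled forms `G i m` (cell `m`,
cells `a0 a1 At B1 B2 c0 c1 D` = `0..7`) and six scaled Harris rows `H k m m'` (`m ≤ m'`) as `(8,2,3,3)` tensors in the chart's box variables `(y,a,b,c)`.
`CertN.Bad S y a b c v`: the cells `v ≥ 0` with `v 3, v 4 > 0` (both `B`-cells are positive at every bad point of every chart — proved per chart) satisfy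
the six rows `≥ 0` and the five forms `> 0` at the box point.  A certificate (`CertN.Cert`: an integer box `Y0 ≤ D y ≤ Y1, …, C0 ≤ D c ≤ C1` and a list of
entries `(kind, idx, e, mu)`) names non-negative multipliers `mu · fac e` where `fac e = (Dy−Y0)^e₁ (Da−A0)^e₂ (Db−B0)^e₃ (Dc−C0)^e₄`, `e = e₁ + 3e₂ + 6e₃ + 12e₄`,
`e₁ ≤ 2`, `e₂,e₃,e₄ ≤ 1` — BOX-RELATIVE factors, non-negative on the box whatever the signs of the coordinates (the blow-up variable `c = (s−1)/y` has both
signs); `kind ≤ 4` weights form `kind` by cell `idx`, `kind = 5` weights row `idx`.  `polyOf S d m m'` is the integer coefficient tensor of the cell monomial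
`v m · v m'` in `Σ (multiplier)·(form or row)`; `check S d` verifies (by the fast record kernel N-III-c, skipping structurally absent tables) that all its 432 control values on the box are `≤ 0` for all
36 monomials, that the entries are well-formed and that some CONSTANT `B`-cell form multiplier is positive.  Soundness (`check ⟹ no bad point in the box`)
is file LXVII; the table degree condition `specOk` (tables inside their DECLARED multidegrees `dG`/`dH`; an entry's factor must keep degree + exponent inside\n(8,2,3,3), so that the shifts never overflow) is checked once per chart.
[this work].
-/

namespace Summit.CriticalPhenomena.PercolationContinuityZ3.Theorems

namespace Quant

namespace CertN

open BoxPolyP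

/-! ## Charts as data; the chart system -/

/-- A multidegree bound `(y, a, b, c)`. -/
structure Deg where
  y : ℕ
  a : ℕ
  b : ℕ
  c : ℕ

/-- A chart: integer coefficient tables (tensors of multidegree ≤ (8,2,3,3) in the box variables `(y,a,b,c)`) of the five scaled forms
(`G i m` = coefficient of cell `m` in form `i`) and of the six scaled Harris rows (`H k m m'` = coefficient of `v m · v m'`, `m ≤ m'`), with DECLARED
multidegree bounds `dG i` (all cells of form `i`) and `dH k` (all monomials of row `k`) — checked by `specOk`, used to bound the multiplier factors. -/
structure Spec where
  G : Fin 5 → Fin 8 → P4 ℤ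
  H : Fin 6 → Fin 8 → Fin 8 → P4 ℤ
  dG : Fin 5 → Deg
  dH : Fin 6 → Deg

/-- All coefficients of `q` outside the multidegree `D` vanish. -/
def fitsB (q : P4 ℤ) (D : Deg) : Bool :=
  (List.finRange 9).all fun i => (List.finRange 3).all fun j => (List.finRange 4).all fun k => (List.finRange 4).all fun l =>
    decide (i.val ≤ D.y ∧ j.val ≤ D.a ∧ k.val ≤ D.b ∧ l.val ≤ D.c) || decide (q i j k l = 0)

/-- The tables respect their declared degree bounds (checked once per chart, by `decide`). -/
def specOk (S : Spec) : Bool :=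
  ((List.finRange 5).all fun i => (List.finRange 8).all fun m => fitsB (S.G i m) (S.dG i)) &&
    ((List.finRange 6).all fun k => (List.finRange 8).all fun m => (List.finRange 8).all fun m' => fitsB (S.H k m m') (S.dH k))

/-- Declared degree of form `kind` (by natural index; the container bound outside `0..4`). -/
def dGN (S : Spec) (kind : ℕ) : Deg := if h : kind < 5 then S.dG ⟨kind, h⟩ else ⟨8, 2, 3, 3⟩

/-- Declared degree of row `k` (by natural index). -/
def dHN (S : Spec) (k : ℕ) : Deg := if h : k < 6 then S.dH ⟨k, h⟩ else ⟨8, 2, 3, 3⟩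

/-- The factor with exponent code `e` times a table of degree `D` stays inside the container `(8,2,3,3)`. -/
def degOk (D : Deg) (e : ℕ) : Bool :=
  decide (D.y + e % 3 ≤ 8 ∧ D.a + e / 3 % 2 ≤ 2 ∧ D.b + e / 6 % 2 ≤ 3 ∧ D.c + e / 12 % 2 ≤ 3)

noncomputable section

/-- Real value of an integer table polynomial at the box point `(y,a,b,c)`. -/
def ev (q : P4 ℤ) (y a b c : ℝ) : ℝ := eval4 (castP4 q) y a b c

/-- Value of scaled form `i` at cells `v`. -/
def formVal (S : Spec) (i : Fin 5) (y a b c : ℝ) (v : Fin 8 → ℝ) : ℝ :=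
  ev (S.G i 0) y a b c * v 0 +
    ev (S.G i 1) y a b c * v 1 +
    ev (S.G i 2) y a b c * v 2 +
    ev (S.G i 3) y a b c * v 3 +
    ev (S.G i 4) y a b c * v 4 +
    ev (S.G i 5) y a b c * v 5 +
    ev (S.G i 6) y a b c * v 6 +
    ev (S.G i 7) y a b c * v 7

/-- Value of scaled Harris row `k` at cells `v`. -/
def rowVal (S : Spec) (k : Fin 6) (y a b c : ℝ) (v : Fin 8 → ℝ) : ℝ :=
  ev (S.H k 0 0) y a b c * (v 0 * v 0) +
    ev (S.H k 0 1) y a b c * (v 0 * v 1) +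
    ev (S.H k 0 2) y a b c * (v 0 * v 2) +
    ev (S.H k 0 3) y a b c * (v 0 * v 3) +
    ev (S.H k 0 4) y a b c * (v 0 * v 4) +
    ev (S.H k 0 5) y a b c * (v 0 * v 5) +
    ev (S.H k 0 6) y a b c * (v 0 * v 6) +
    ev (S.H k 0 7) y a b c * (v 0 * v 7) +
    ev (S.H k 1 1) y a b c * (v 1 * v 1) +
    ev (S.H k 1 2) y a b c * (v 1 * v 2) +
    ev (S.H k 1 3) y a b c * (v 1 * v 3) +
    ev (S.H k 1 4) y a b c * (v 1 * v 4) +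
    ev (S.H k 1 5) y a b c * (v 1 * v 5) +
    ev (S.H k 1 6) y a b c * (v 1 * v 6) +
    ev (S.H k 1 7) y a b c * (v 1 * v 7) +
    ev (S.H k 2 2) y a b c * (v 2 * v 2) +
    ev (S.H k 2 3) y a b c * (v 2 * v 3) +
    ev (S.H k 2 4) y a b c * (v 2 * v 4) +
    ev (S.H k 2 5) y a b c * (v 2 * v 5) +
    ev (S.H k 2 6) y a b c * (v 2 * v 6) +
    ev (S.H k 2 7) y a b c * (v 2 * v 7) +
    ev (S.H k 3 3) y a b c * (v 3 * v 3) +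
    ev (S.H k 3 4) y a b c * (v 3 * v 4) +
    ev (S.H k 3 5) y a b c * (v 3 * v 5) +
    ev (S.H k 3 6) y a b c * (v 3 * v 6) +
    ev (S.H k 3 7) y a b c * (v 3 * v 7) +
    ev (S.H k 4 4) y a b c * (v 4 * v 4) +
    ev (S.H k 4 5) y a b c * (v 4 * v 5) +
    ev (S.H k 4 6) y a b c * (v 4 * v 6) +
    ev (S.H k 4 7) y a b c * (v 4 * v 7) +
    ev (S.H k 5 5) y a b c * (v 5 * v 5) +
    ev (S.H k 5 6) y a b c * (v 5 * v 6) +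
    ev (S.H k 5 7) y a b c * (v 5 * v 7) +
    ev (S.H k 6 6) y a b c * (v 6 * v 6) +
    ev (S.H k 6 7) y a b c * (v 6 * v 7) +
    ev (S.H k 7 7) y a b c * (v 7 * v 7)

end

/-- A BAD POINT of chart `S` at the box point `(y,a,b,c)`: cells `v ≥ 0` with `v 3 > 0`, `v 4 > 0`, the six rows `≥ 0` and the five forms `> 0`. -/
def Bad (S : Spec) (y a b c : ℝ) (v : Fin 8 → ℝ) : Prop :=
  (∀ m, 0 ≤ v m) ∧ 0 < v 3 ∧ 0 < v 4 ∧ (∀ k, 0 ≤ rowVal S k y a b c v) ∧ (∀ i, 0 < formVal S i y a b c v)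

/-! ## Certificates -/

/-- One multiplier entry: `kind` (`0..4` = form, `5` = Harris row), `idx` (cell `0..7` for a form, row `0..5`), the exponent code `e = e₁ + 3e₂ + 6e₃ + 12e₄`
of the box-relative factor, and the non-negative integer coefficient `mu`. -/
structure Entry where
  kind : ℕ
  idx : ℕ
  e : ℕ
  mu : ℕ

/-- A box certificate: the integer box `Y0 ≤ D·y ≤ Y1`, `A0 ≤ D·a ≤ A1`, `B0 ≤ D·b ≤ B1`, `C0 ≤ D·c ≤ C1` (`0 < D`) and the multiplier entries. -/
structure Cert where
  D : ℕ
  Y0 : ℤ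
  Y1 : ℤ
  A0 : ℤ
  A1 : ℤ
  B0 : ℤ
  B1 : ℤ
  C0 : ℤ
  C1 : ℤ
  entries : List Entry

/-- An entry is well-formed: indices in range and its factor fits the declared degree of every table it multiplies. -/
def entryOk (S : Spec) (en : Entry) : Bool :=
  decide (en.e < 24) &&
    ((decide (en.kind ≤ 4 ∧ en.idx ≤ 7) && degOk (dGN S en.kind) en.e) || (decide (en.kind = 5 ∧ en.idx ≤ 5) && degOk (dHN S en.idx) en.e))

/-- Some CONSTANT form multiplier on a `B`-cell (`idx = 3` or `4`) is positive (strictness of the final inequality). -/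
def posOk (d : Cert) : Bool :=
  d.entries.any fun en => decide (en.kind ≤ 4 ∧ (en.idx = 3 ∨ en.idx = 4) ∧ en.e = 0 ∧ 0 < en.mu)

noncomputable section

/-- The box-relative factor with exponent code `e`: `(Dy−Y0)^(e%3) (Da−A0)^(e/3%2) (Db−B0)^(e/6%2) (Dc−C0)^(e/12%2)`. -/
def fac (d : Cert) (e : ℕ) (y a b c : ℝ) : ℝ :=
  ((d.D : ℝ) * y - d.Y0) ^ (e % 3) * (((d.D : ℝ) * a - d.A0) ^ (e / 3 % 2) * (((d.D : ℝ) * b - d.B0) ^ (e / 6 % 2) * ((d.D : ℝ) * c - d.C0) ^ (e / 12 % 2)))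

/-- Real weight of an entry at the box point. -/
def wt (d : Cert) (en : Entry) (y a b c : ℝ) : ℝ := (en.mu : ℝ) * fac d en.e y a b c

/-- The form multipliers `lam i m` (form `i` weighted by cell `m`) defined by a list of entries. -/
def lamL (d : Cert) (L : List Entry) (y a b c : ℝ) (i : Fin 5) (m : Fin 8) : ℝ :=
  (L.map fun en => if en.kind = i.val ∧ en.idx = m.val then wt d en y a b c else 0).sum

/-- The row multipliers `nu k` defined by a list of entries. -/
def nuL (d : Cert) (L : List Entry) (y a b c : ℝ) (k : Fin 6) : ℝ :=
  (L.map fun en => if en.kind = 5 ∧ en.idx = k.val then wt d en y a b c else 0).sum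

end

/-! ## The assembled coefficient tensors (functional version for the proofs, record version for `decide`) -/

/-- Form table by natural kind (`zero` outside `0..4`). -/
def GN (S : Spec) (kind : ℕ) (m : Fin 8) : P4 ℤ := if h : kind < 5 then S.G ⟨kind, h⟩ m else BoxPolyP.zero

/-- Row table by natural index (`zero` outside `0..5`). -/
def HN (S : Spec) (k : ℕ) (m m' : Fin 8) : P4 ℤ := if h : k < 6 then S.H ⟨k, h⟩ m m' else BoxPolyP.zero

/-- Multiplication by the factor `D·y − Y0`. -/
def mulY (d : Cert) (q : P4 ℤ) : P4 ℤ := add (smul (d.D : ℤ) (shiftY q)) (smul (-d.Y0) q)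
/-- Multiplication by the factor `D·a − A0`. -/
def mulA (d : Cert) (q : P4 ℤ) : P4 ℤ := add (smul (d.D : ℤ) (shiftA q)) (smul (-d.A0) q)
/-- Multiplication by the factor `D·b − B0`. -/
def mulB (d : Cert) (q : P4 ℤ) : P4 ℤ := add (smul (d.D : ℤ) (shiftB q)) (smul (-d.B0) q)
/-- Multiplication by the factor `D·c − C0`. -/
def mulC (d : Cert) (q : P4 ℤ) : P4 ℤ := add (smul (d.D : ℤ) (shiftC q)) (smul (-d.C0) q)

/-- `n`-fold (`n ≤ 2`) multiplication by `D·y − Y0`. -/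
def powY (d : Cert) (n : ℕ) (q : P4 ℤ) : P4 ℤ := if n = 0 then q else if n = 1 then mulY d q else mulY d (mulY d q)
/-- Optional multiplication by `D·a − A0`. -/
def optA (d : Cert) (bit : ℕ) (q : P4 ℤ) : P4 ℤ := if bit = 1 then mulA d q else q
/-- Optional multiplication by `D·b − B0`. -/
def optB (d : Cert) (bit : ℕ) (q : P4 ℤ) : P4 ℤ := if bit = 1 then mulB d q else q
/-- Optional multiplication by `D·c − C0`. -/
def optC (d : Cert) (bit : ℕ) (q : P4 ℤ) : P4 ℤ := if bit = 1 then mulC d q else q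

/-- Multiplication by the box-relative factor with exponent code `e`. -/
def monoMul (d : Cert) (e : ℕ) (q : P4 ℤ) : P4 ℤ :=
  optC d (e / 12 % 2) (optB d (e / 6 % 2) (optA d (e / 3 % 2) (powY d (e % 3) q)))

/-- One weighted, factor-multiplied table (`zero` — and no work — when the table is structurally absent). -/
def term (d : Cert) (en : Entry) (t : P4 ℤ) : P4 ℤ :=
  if (V432.ofP4 t).isZero then BoxPolyP.zero else smul (en.mu : ℤ) (monoMul d en.e t)

/-- Contribution of one entry to the coefficient tensor of the cell monomial `v m · v m'` (`m ≤ m'`). -/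
def contrib (S : Spec) (d : Cert) (en : Entry) (m m' : Fin 8) : P4 ℤ :=
  if en.kind ≤ 4 then
    add (if en.idx = m.val then term d en (GN S en.kind m') else BoxPolyP.zero)
      (if en.idx = m'.val ∧ m ≠ m' then term d en (GN S en.kind m) else BoxPolyP.zero)
  else if en.kind = 5 then term d en (HN S en.idx m m')
  else BoxPolyP.zero

/-- The coefficient tensor of `v m · v m'` in `Σ multipliers · (forms, rows)`. -/
def polyOf (S : Spec) (d : Cert) (m m' : Fin 8) : P4 ℤ :=
  d.entries.foldr (fun en acc => add (contrib S d en m m') acc) BoxPolyP.zero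

/-- Record version of `mulY`. -/
def mulYV (d : Cert) (x : V432) : V432 := V432.lin (d.D : ℤ) (V432.shiftY x) (-d.Y0) x
/-- Record version of `mulA`. -/
def mulAV (d : Cert) (x : V432) : V432 := V432.lin (d.D : ℤ) (V432.shiftA x) (-d.A0) x
/-- Record version of `mulB`. -/
def mulBV (d : Cert) (x : V432) : V432 := V432.lin (d.D : ℤ) (V432.shiftB x) (-d.B0) x
/-- Record version of `mulC`. -/
def mulCV (d : Cert) (x : V432) : V432 := V432.lin (d.D : ℤ) (V432.shiftC x) (-d.C0) x

/-- Record version of `powY`. -/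
def powYV (d : Cert) (n : ℕ) (x : V432) : V432 := if n = 0 then x else if n = 1 then mulYV d x else mulYV d (mulYV d x)
/-- Record version of `optA`. -/
def optAV (d : Cert) (bit : ℕ) (x : V432) : V432 := if bit = 1 then mulAV d x else x
/-- Record version of `optB`. -/
def optBV (d : Cert) (bit : ℕ) (x : V432) : V432 := if bit = 1 then mulBV d x else x
/-- Record version of `optC`. -/
def optCV (d : Cert) (bit : ℕ) (x : V432) : V432 := if bit = 1 then mulCV d x else x

/-- Record version of `monoMul`. -/
def monoMulV (d : Cert) (e : ℕ) (x : V432) : V432 :=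
  optCV d (e / 12 % 2) (optBV d (e / 6 % 2) (optAV d (e / 3 % 2) (powYV d (e % 3) x)))

/-- Record version of `term`, accumulated: tabulate the table; skip it if all-zero; else add `mu •` its factor multiple. -/
def termV (d : Cert) (en : Entry) (t : P4 ℤ) (acc : V432) : V432 :=
  let x := V432.ofP4 t
  if x.isZero then acc else V432.addSmul (en.mu : ℤ) (monoMulV d en.e x) acc

/-- Record version of one entry's contribution, accumulated. -/
def stepV (S : Spec) (d : Cert) (en : Entry) (m m' : Fin 8) (acc : V432) : V432 :=
  if en.kind ≤ 4 then
    let acc₁ := if en.idx = m.val then termV d en (GN S en.kind m') acc else acc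
    if en.idx = m'.val ∧ m ≠ m' then termV d en (GN S en.kind m) acc₁ else acc₁
  else if en.kind = 5 then termV d en (HN S en.idx m m') acc
  else acc

/-- Record version of `polyOf`. -/
def polyOfV (S : Spec) (d : Cert) (m m' : Fin 8) : V432 :=
  d.entries.foldr (stepV S d · m m') V432.zero

/-- The 36 cell monomials `(m, m')`, `m ≤ m'`. -/
def monos : List (Fin 8 × Fin 8) :=
  [(0, 0), (0, 1), (0, 2), (0, 3), (0, 4), (0, 5), (0, 6), (0, 7), (1, 1), (1, 2), (1, 3), (1, 4), (1, 5), (1, 6), (1, 7), (2, 2), (2, 3), (2, 4), (2, 5), (2, 6), (2, 7), (3, 3), (3, 4), (3, 5), (3, 6), (3, 7), (4, 4), (4, 5), (4, 6), (4, 7), (5, 5), (5, 6), (5, 7), (6, 6), (6, 7), (7, 7)]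

/-- All 432 control values of the coefficient tensor of `v m · v m'` on the certificate's box are `≤ 0` (record kernel). -/
def pairOk (S : Spec) (d : Cert) (mm : Fin 8 × Fin 8) : Bool :=
  (V432.ctrlF d.Y0 d.Y1 d.A0 d.A1 d.B0 d.B1 d.C0 d.C1 (d.D : ℤ) (polyOfV S d mm.1 mm.2)).nonpos

/-- **The checker**: positive denominator, well-formed entries, a positive constant `B`-cell multiplier, and all 36 × 432 control values `≤ 0`. -/
def check (S : Spec) (d : Cert) : Bool :=
  decide (0 < d.D) && d.entries.all (entryOk S) && posOk d && monos.all (pairOk S d)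

end CertN

end Quant

end Summit.CriticalPhenomena.PercolationContinuityZ3.Theorems
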